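import Literature.Geometry.Riemannian.CosDistHeatSubsolution
import Literature.Geometry.Riemannian.HeatPropagationContinuousDataSmooth
import HarnessLib

/-!
# `(Δ + m) P_τ cos d_p ≥ 0`: the heat-flow smoothing of `cos d_p` is a genuine subsolution
# (Colding's smoothing step through the heat flow of the fixed metric)

`CosDistHeatSubsolution.lean` proved the integrated subsolution property of `u = cos d(p, ·)` under
`Ric ≥ (m-1) g` on a closed `m`-manifold: for the heat kernel measures of the static family
`r ↦ g`, `s ↦ e^{-ms} ∫ u dν_{x,t;s}` is nonincreasing.
`HeatPropagationContinuousDataSmooth.lean` proved that the heat propagation `(P_{s→t}u)(x)` of a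
continuous datum is `C^∞` in `(x, t)` for `t > s` and solves `∂ₜ = Δ`. This file combines them:

* `heatValue_static_add_const`, `heatValueC_static_add_const`,
  `integral_heatKernelMeasure_static_add_const` — **time-translation invariance of the heat
  propagation of a fixed metric**: `P_{s+c → t+c} = P_{s → t}` (uniqueness of smooth solutions,
  `IsHeatSolutionOn.comp_add_const`; limits for continuous data);
* `exp_mul_heatValueC_cos_edist_mono` — `τ ↦ e^{mτ} (P_τ cos d_p)(x)` is nondecreasing on
  `(0, ∞)` (`P_τ = P_{0→τ}`);
* **`laplaceBeltrami_heatValueC_cos_edist_add_mul_nonneg`** —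
  `Δ_g (P_τ cos d_p)(x) + m (P_τ cos d_p)(x) ≥ 0` for every `τ > 0` and `x` (differentiate the
  monotone function; `∂_τ P_τ u = Δ P_τ u`).

This is the smoothing step of Colding's proof of the volume sphere theorem
(`Colding1996_volume_ghClose`; Colding 1996a, §1 / Colding 1997, sketch of the proof of Thm. 1.1:
"`cos d_p` is almost a solution of `Δf = -nf`; smooth it"), with the heat flow of `g` as the
smoothing operator. Everything here is proved; no definitions, no named facts (D-0026).

## References

* T. H. Colding, *Shape of manifolds with positive Ricci curvature*, Invent. Math. 124 (1996)
  175–191, §1. [Colding1996Shape]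
* T. H. Colding, *Aspects of Ricci curvature*, in *Comparison Geometry* (1997), §1, sketch of the
  proof of Thm. 1.1. [Colding1997Aspects]
* R. H. Bamler, *Entropy and heat kernel bounds on a Ricci flow background* (2020), §2.
  [Bamler2020Entropy]
-/

noncomputable section

open Set Function Filter MeasureTheory
open scoped Manifold ContDiff Topology ENNReal NNReal

namespace Literature.Geometry.Riemannian

open Lorentzian Lorentzian.PseudoRiemannianMetric

/-! ### §1 Time-translation invariance of the heat propagation of a fixed metric -/

section Static

variable {m : ℕ} {H : Type*} [TopologicalSpace H]
  {I : ModelWithCorners ℝ (EuclideanSpace ℝ (Fin m)) H} [I.Boundaryless]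
  {M : Type*} [TopologicalSpace M] [ChartedSpace H M] [IsManifold I ∞ M]
  [T2Space M] [CompactSpace M] [SecondCountableTopology M] [MeasurableSpace M] [BorelSpace M]
  (g : PseudoRiemannianMetric I ∞ (EuclideanSpace ℝ (Fin m)) (TangentSpace I : M → Type _))

/-- **Time-translation invariance, smooth data**: for the constant family `r ↦ g` of a Riemannian
metric on a closed manifold, `(P_{s+c → t+c} φ)(x) = (P_{s → t} φ)(x)` for smooth `φ` (a smooth
solution on `M × [s+c, t+c]` translates to one on `M × [s, t]` of the same family,
`IsHeatSolutionOn.comp_add_const`, and the propagation is the value of any solution,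
`heatValue_eq`). [cite: Bamler2020Entropy, §2] -/
theorem heatValue_static_add_const (hg : g.IsRiemannian) (s t c : ℝ) (x : M) {φ : M → ℝ}
    (hφ : ContMDiff I 𝓘(ℝ, ℝ) ∞ φ) :
    heatValue (fun _ : ℝ ↦ g) (s + c) (t + c) x φ = heatValue (fun _ : ℝ ↦ g) s t x φ := by
  rcases le_or_gt t s with hts | hst
  · rw [heatValue_of_le (by linarith) x φ, heatValue_of_le hts x φ]
  have hh : IsContMDiffFamilyOn ∞ (fun _ : ℝ ↦ g) univ := isContMDiffFamilyOn_const g univ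
  have hR : ∀ r : ℝ, ((fun _ : ℝ ↦ g) r).IsRiemannian := fun _ ↦ hg
  obtain ⟨w, hw, h0, hv⟩ :=
    exists_isHeatSolutionOn_heatValue hh hR (by linarith : s + c < t + c) hφ
  have hw' : IsHeatSolutionOn (fun _ : ℝ ↦ g) (fun r ↦ w (r + c)) s t := by
    have := hw.comp_add_const c
    simp only [add_sub_cancel_right] at this
    exact this
  rw [hv (t + c) ⟨by linarith, le_rfl⟩ x]
  exact (heatValue_eq hR hst hw' (φ := φ) h0 x).symm

/-- **Time-translation invariance, continuous data**: `(P_{s+c → t+c} φ)(x) = (P_{s → t} φ)(x)` for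
continuous `φ` (limits of the smooth approximants). [cite: Bamler2020Entropy, §2] -/
theorem heatValueC_static_add_const (hg : g.IsRiemannian) (s t c : ℝ) (x : M) {φ : M → ℝ}
    (hφ : Continuous φ) :
    heatValueC (fun _ : ℝ ↦ g) (s + c) (t + c) x φ = heatValueC (fun _ : ℝ ↦ g) s t x φ := by
  have hh : IsContMDiffFamilyOn ∞ (fun _ : ℝ ↦ g) univ := isContMDiffFamilyOn_const g univ
  have hR : ∀ r : ℝ, ((fun _ : ℝ ↦ g) r).IsRiemannian := fun _ ↦ hg
  have h1 := tendsto_heatValue_smoothApprox hh hR (s + c) (t + c) x hφ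
  have h2 := tendsto_heatValue_smoothApprox hh hR s t x hφ
  have e : (fun n ↦ heatValue (fun _ : ℝ ↦ g) (s + c) (t + c) x (smoothApprox I φ n)) =
      fun n ↦ heatValue (fun _ : ℝ ↦ g) s t x (smoothApprox I φ n) :=
    funext fun n ↦ heatValue_static_add_const g hg s t c x (contMDiff_smoothApprox hφ n)
  rw [e] at h1
  exact tendsto_nhds_unique h1 h2

/-- **Time-translation invariance of the heat kernel measures of a fixed metric**, tested on
continuous functions: `∫ φ dν_{x,t+c;s+c} = ∫ φ dν_{x,t;s}` for `s < t`.
[cite: Bamler2020Entropy, §2.3] -/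
theorem integral_heatKernelMeasure_static_add_const (hg : g.IsRiemannian)
    (hh : IsContMDiffFamilyOn ∞ (fun _ : ℝ ↦ g) univ) (hR : ∀ _ : ℝ, g.IsRiemannian)
    {s t : ℝ} (hst : s < t) (c : ℝ) (x : M) {φ : M → ℝ} (hφ : Continuous φ) :
    ∫ y, φ y ∂(heatKernelMeasure hh hR (t + c) x (s + c)) =
      ∫ y, φ y ∂(heatKernelMeasure hh hR t x s) := by
  rw [integral_heatKernelMeasure hh hR (by linarith) x hφ, integral_heatKernelMeasure hh hR hst x hφ,
    heatValueC_static_add_const g hg s t c x hφ]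

end Static

/-! ### §2 `(Δ + m) P_τ cos d_p ≥ 0` -/

section CosDist

variable {m : ℕ} {M : Type*} [TopologicalSpace M] [T2Space M] [SecondCountableTopology M]
  [ChartedSpace (EuclideanSpace ℝ (Fin m)) M] [IsManifold (𝓡 m) ∞ M]
  [MeasurableSpace M] [BorelSpace M]
  (g : PseudoRiemannianMetric (𝓡 m) ∞ (EuclideanSpace ℝ (Fin m)) (TangentSpace (𝓡 m) : M → Type _))
  [ConnectedSpace M] [CompactSpace M] [g.HasLeviCivita]

omit [SecondCountableTopology M] [MeasurableSpace M] [BorelSpace M] [g.HasLeviCivita] in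
/-- `y ↦ cos d(p, y)` is continuous. [folklore] -/
theorem continuous_cos_edist (hg : g.IsRiemannian) (p : M) :
    Continuous fun y : M ↦ Real.cos (g.edist hg p y).toReal :=
  Real.continuous_cos.comp (ENNReal.continuousOn_toReal.comp_continuous
    ((PseudoRiemannianMetric.continuous_edist hg).comp (Continuous.prodMk_right p))
    fun y ↦ PseudoRiemannianMetric.edist_ne_top hg p y)

/-- **`τ ↦ e^{mτ} (P_τ cos d_p)(x)` is nondecreasing on `(0, ∞)`** (closed `m`-manifold, `m ≥ 2`,
`Ric ≥ (m-1) g`; `P_τ = P_{0→τ}` the heat propagation of `g`): the monotonicity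
`exp_mul_integral_cos_edist_heatKernelMeasure_le` of the heat kernel measures in the initial time,
read through `∫ u dν_{x,t;s} = (P_{s→t}u)(x)` and the time-translation invariance
`P_{s→t} = P_{0→t−s}`. [cite: Colding1997Aspects, §1, sketch of proof of Thm. 1.1]
[cite: Colding1996Shape, §1] -/
theorem exp_mul_heatValueC_cos_edist_mono (hg : g.IsRiemannian) (hm : 2 ≤ m)
    (hRic : ∀ (x : M) (w : TangentSpace (𝓡 m) x), ((m : ℝ) - 1) * g.val x w w ≤ g.ricci x w w)
    (p x : M) {τ₁ τ₂ : ℝ} (h0 : 0 < τ₂) (h12 : τ₂ ≤ τ₁) :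
    Real.exp ((m : ℝ) * τ₂) *
        heatValueC (fun _ : ℝ ↦ g) 0 τ₂ x (fun y ↦ Real.cos (g.edist hg p y).toReal) ≤
      Real.exp ((m : ℝ) * τ₁) *
        heatValueC (fun _ : ℝ ↦ g) 0 τ₁ x (fun y ↦ Real.cos (g.edist hg p y).toReal) := by
  rcases h12.eq_or_lt with rfl | hlt
  · exact le_rfl
  have hh : IsContMDiffFamilyOn ∞ (fun _ : ℝ ↦ g) univ := isContMDiffFamilyOn_const g univ
  have hR : ∀ _ : ℝ, g.IsRiemannian := fun _ ↦ hg
  have hcont := continuous_cos_edist g hg p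
  have key := exp_mul_integral_cos_edist_heatKernelMeasure_le g hg hm hRic hh hR p x
    (s₁ := 0) (s₂ := τ₁ - τ₂) (t := τ₁) (by linarith) (by linarith)
  rw [integral_heatKernelMeasure hh hR (by linarith) x hcont,
    integral_heatKernelMeasure hh hR (by linarith) x hcont, sub_zero] at key
  have htr : heatValueC (fun _ : ℝ ↦ g) (τ₁ - τ₂) τ₁ x (fun y ↦ Real.cos (g.edist hg p y).toReal) =
      heatValueC (fun _ : ℝ ↦ g) 0 τ₂ x (fun y ↦ Real.cos (g.edist hg p y).toReal) := by
    have := heatValueC_static_add_const g hg 0 τ₂ (τ₁ - τ₂) x hcont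
    rwa [zero_add, show τ₂ + (τ₁ - τ₂) = τ₁ by ring] at this
  rw [htr] at key
  have h2 := mul_le_mul_of_nonneg_left key (Real.exp_pos ((m : ℝ) * τ₁)).le
  rwa [← mul_assoc, ← Real.exp_add, show (m : ℝ) * τ₁ + -(m : ℝ) * (τ₁ - τ₂) = (m : ℝ) * τ₂ by
    ring] at h2

/-- **`(Δ + m) P_τ cos d_p ≥ 0`** (Colding 1996a, §1 / Colding 1997, sketch of the proof of
Thm. 1.1, through the heat flow): on a closed `m`-manifold, `m ≥ 2`, with `Ric ≥ (m-1) g`, for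
every `p`, every `τ > 0` and every `x`,
  `Δ_g (P_τ cos d_p)(x) + m (P_τ cos d_p)(x) ≥ 0`,
where `P_τ = P_{0→τ}` is the heat propagation of `g` (smooth in `(x, τ)` for `τ > 0` with
`∂_τ P_τ u = Δ P_τ u`, `contMDiffOn_and_deriv_heatValueC_spaceTime`): the derivative of the
nondecreasing function `τ ↦ e^{mτ}(P_τ cos d_p)(x)` is `e^{mτ}((Δ + m) P_τ cos d_p)(x) ≥ 0`.
[cite: Colding1997Aspects, §1, sketch of proof of Thm. 1.1] [cite: Colding1996Shape, §1] -/
theorem laplaceBeltrami_heatValueC_cos_edist_add_mul_nonneg (hg : g.IsRiemannian) (hm : 2 ≤ m)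
    (hRic : ∀ (x : M) (w : TangentSpace (𝓡 m) x), ((m : ℝ) - 1) * g.val x w w ≤ g.ricci x w w)
    (p x : M) {τ : ℝ} (hτ : 0 < τ) :
    0 ≤ g.laplaceBeltrami
          (fun y ↦ heatValueC (fun _ : ℝ ↦ g) 0 τ y (fun z ↦ Real.cos (g.edist hg p z).toReal)) x +
        (m : ℝ) * heatValueC (fun _ : ℝ ↦ g) 0 τ x (fun z ↦ Real.cos (g.edist hg p z).toReal) := by
  have hh : IsContMDiffFamilyOn ∞ (fun _ : ℝ ↦ g) univ := isContMDiffFamilyOn_const g univ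
  have hR : ∀ r : ℝ, ((fun _ : ℝ ↦ g) r).IsRiemannian := fun _ ↦ hg
  have hcont := continuous_cos_edist g hg p
  set u : M → ℝ := fun z ↦ Real.cos (g.edist hg p z).toReal with hu
  set F : ℝ → ℝ := fun t ↦ heatValueC (fun _ : ℝ ↦ g) 0 t x u with hF
  set G : ℝ → ℝ := fun t ↦ Real.exp ((m : ℝ) * t) * F t with hG
  have hmono : MonotoneOn G (Ioi 0) := fun a ha b _ hab ↦
    exp_mul_heatValueC_cos_edist_mono g hg hm hRic p x ha hab
  -- `F` is differentiable at `τ` with derivative `Δ (P_τ u)(x)`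
  obtain ⟨hsm, hder⟩ := contMDiffOn_and_deriv_heatValueC_spaceTime hh hR 0 hcont
  have hO : (univ ×ˢ Ioi (0 : ℝ) : Set (M × ℝ)) ∈ 𝓝 ((x, τ) : M × ℝ) :=
    (isOpen_univ.prod isOpen_Ioi).mem_nhds ⟨mem_univ _, hτ⟩
  have hF1 : ContMDiffAt 𝓘(ℝ, ℝ) 𝓘(ℝ, ℝ) ∞ F τ := by
    have h1 : ContMDiffAt 𝓘(ℝ, ℝ) ((𝓡 m).prod 𝓘(ℝ, ℝ)) ∞ (fun t : ℝ ↦ ((x, t) : M × ℝ)) τ :=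
      (contMDiff_const.prodMk contMDiff_id).contMDiffAt
    exact (hsm.contMDiffAt hO).comp τ h1
  have hFd : DifferentiableAt ℝ F τ :=
    (contMDiffAt_iff_contDiffAt.1 hF1).differentiableAt (by simp)
  have hFder : deriv F τ = g.laplaceBeltrami (fun y ↦ heatValueC (fun _ : ℝ ↦ g) 0 τ y u) x :=
    hder (x, τ) ⟨mem_univ _, hτ⟩
  have hF' : HasDerivAt F (g.laplaceBeltrami (fun y ↦ heatValueC (fun _ : ℝ ↦ g) 0 τ y u) x) τ :=
    hFder ▸ hFd.hasDerivAt
  -- the derivative of `G`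
  have hexp : HasDerivAt (fun t ↦ Real.exp ((m : ℝ) * t)) (Real.exp ((m : ℝ) * τ) * (m : ℝ)) τ := by
    simpa using ((hasDerivAt_id τ).const_mul (m : ℝ)).exp
  have hG' : HasDerivAt G (Real.exp ((m : ℝ) * τ) * (m : ℝ) * F τ +
      Real.exp ((m : ℝ) * τ) * g.laplaceBeltrami (fun y ↦ heatValueC (fun _ : ℝ ↦ g) 0 τ y u) x) τ :=
    hexp.mul hF'
  -- a nondecreasing function has nonnegative derivative
  have h0 : 0 ≤ derivWithin G (Ioi 0) τ := hmono.derivWithin_nonneg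
  rw [derivWithin_of_mem_nhds (Ioi_mem_nhds hτ), hG'.deriv] at h0
  have hpos : 0 < Real.exp ((m : ℝ) * τ) := Real.exp_pos _
  have h1 : 0 ≤ Real.exp ((m : ℝ) * τ) *
      (g.laplaceBeltrami (fun y ↦ heatValueC (fun _ : ℝ ↦ g) 0 τ y u) x + (m : ℝ) * F τ) := by
    have e : Real.exp ((m : ℝ) * τ) * (m : ℝ) * F τ +
        Real.exp ((m : ℝ) * τ) * g.laplaceBeltrami (fun y ↦ heatValueC (fun _ : ℝ ↦ g) 0 τ y u) x =
        Real.exp ((m : ℝ) * τ) *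
          (g.laplaceBeltrami (fun y ↦ heatValueC (fun _ : ℝ ↦ g) 0 τ y u) x + (m : ℝ) * F τ) := by
      ring
    rwa [e] at h0
  exact nonneg_of_mul_nonneg_right h1 hpos

end CosDist

end Literature.Geometry.Riemannian

end
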